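import Summits.QuantumFields.YangMills.Theorems.PoincareLipschitzOrbitMinimiserKirchhoff
import Summits.QuantumFields.YangMills.Theorems.UnitScaleTiltProp7Taylor3ExpChart
import HarnessLib

/-!
# Crux stmt-QuantumFields-19936 `UnitScaleTilt.HistoryTailL`, K2 at depth (route crux `PoincareLipschitz.BlockLipschitzL`, stmt-QuantumFields-23533):
# THE LINEARISED COULOMB CONDITION OF A BOX-ℓ²-ORBIT MINIMISER, WITH A CUBIC DEFECT

✓`PoincareLipschitzOrbitMinKirchhoff.kirchhoff_of_orbitMin` (this seat, p682908): at a box-`ℓ²`-orbit-minimising pair the bond current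
`J_b = W_b − W_b⁻¹`, `W_b = U'_bU_b⁻¹`, is covariantly conserved at every site.  In the perturbative regime of the supplier's statement of record h⋆
(✓p683030) one writes `W_b = exp Y_b` with `‖Y_b‖ ≤ 1`; then `W_b − W_b⁻¹ = e^{Y_b} − e^{−Y_b} = 2Y_b + R_b` with `‖R_b‖ ≤ 2‖Y_b‖³` (third-order
Taylor remainder of `exp` in `M₂(ℂ)`, ✓`norm_exp_sub_one_sub_sub_half_sq_le`), and conservation of `J` becomes the LINEAR covariant Coulomb condition
`D_U^* Y (x) := Σ_{b∈box,b₋=x} Y_b − Σ_{b∈box,b₊=x} U_b⁻¹Y_bU_b = O(Σ_{b∋x}‖Y_b‖³)` — `norm_covDiv_le_of_orbitMin` below: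

  `‖Σ_{b∈box, b₋=x} Y_b − Σ_{b∈box, b₊=x} U_b⁻¹·Y_b·U_b‖ ≤ Σ_{b∈box, b₋=x} ‖Y_b‖³ + Σ_{b∈box, b₊=x} ‖Y_b‖³`.

This is the entry point of the elliptic∕true-linearisation steps (R3)(R4) of the K2 supplier plan (card v1.27): the perturbation `Y` of an
orbit-minimising pair is covariantly divergence-free UP TO THIRD ORDER, with no gauge condition imposed by hand.

WHAT THIS IS NOT: nothing here proves h⋆, `stub_iteratedLipschitz`, the crux `BlockLipschitzL`, the crux `HistoryTailL`, rung R3 (YM₃ on T³ — not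
d = 4, not infinite volume, not a mass gap, not the Clay problem) or a summit statement.  Width seat ym-ust-19936-w5 g10 (cell ym3-torus),
`--supports stmt-QuantumFields-19936`.
-/

noncomputable section

open scoped BigOperators Matrix.Norms.L2Operator Matrix

namespace Summit.QuantumFields.YangMills.Theorems.PoincareLipschitzOrbitMinLinearCoulomb

open Literature.MathematicalPhysics.QuantumFieldTheory.Balaban1983to89
open NormedSpace
open Summit.QuantumFields.YangMills.Theorems.PoincareLipschitzOrbitMinKirchhoff (kirchhoff_of_orbitMin coe_inv_eq_conjTranspose)

variable {P : Params}

/-- **`sinh` IS THE IDENTITY TO THIRD ORDER**: `‖(e^Y − e^{−Y}) − 2Y‖ ≤ 2‖Y‖³` for `‖Y‖ ≤ 1` in `M₂(ℂ)` (two third-order Taylor remainders; the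
quadratic terms cancel). [folklore] -/
theorem norm_exp_sub_exp_neg_sub_two_smul_le (Y : Matrix (Fin 2) (Fin 2) ℂ) (hY : ‖Y‖ ≤ 1) :
    ‖(exp Y - exp (-Y)) - (2 : ℂ) • Y‖ ≤ 2 * ‖Y‖ ^ 3 := by
  have h1 := Prop7Taylor3ExpChart.norm_exp_sub_one_sub_sub_half_sq_le (x := Y) hY
  have h2 := Prop7Taylor3ExpChart.norm_exp_sub_one_sub_sub_half_sq_le (x := -Y) (by rwa [norm_neg])
  have e : (exp Y - exp (-Y)) - (2 : ℂ) • Y =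
      (exp Y - 1 - Y - (2 : ℂ)⁻¹ • Y ^ 2) - (exp (-Y) - 1 - (-Y) - (2 : ℂ)⁻¹ • (-Y) ^ 2) := by
    rw [neg_sq, two_smul]
    abel
  rw [e]
  calc ‖(exp Y - 1 - Y - (2 : ℂ)⁻¹ • Y ^ 2) - (exp (-Y) - 1 - (-Y) - (2 : ℂ)⁻¹ • (-Y) ^ 2)‖
      ≤ ‖exp Y - 1 - Y - (2 : ℂ)⁻¹ • Y ^ 2‖ + ‖exp (-Y) - 1 - (-Y) - (2 : ℂ)⁻¹ • (-Y) ^ 2‖ := norm_sub_le _ _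
    _ ≤ ‖Y‖ ^ 3 + ‖-Y‖ ^ 3 := add_le_add h1 h2
    _ = 2 * ‖Y‖ ^ 3 := by rw [norm_neg]; ring

/-- Conjugation by a special unitary matrix does not increase the operator norm. [folklore] -/
theorem norm_conj_le (V : Matrix.specialUnitaryGroup (Fin 2) ℂ) (R : Matrix (Fin 2) (Fin 2) ℂ) :
    ‖(((V⁻¹ : Matrix.specialUnitaryGroup (Fin 2) ℂ)) : Matrix (Fin 2) (Fin 2) ℂ) * R * ((V : Matrix.specialUnitaryGroup (Fin 2) ℂ) : Matrix (Fin 2) (Fin 2) ℂ)‖ ≤ ‖R‖ := by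
  have hV : ‖((V : Matrix.specialUnitaryGroup (Fin 2) ℂ) : Matrix (Fin 2) (Fin 2) ℂ)‖ = 1 :=
    CStarRing.norm_of_mem_unitary (Matrix.mem_specialUnitaryGroup_iff.1 V.2).1
  have hVi : ‖(((V⁻¹ : Matrix.specialUnitaryGroup (Fin 2) ℂ)) : Matrix (Fin 2) (Fin 2) ℂ)‖ = 1 :=
    CStarRing.norm_of_mem_unitary (Matrix.mem_specialUnitaryGroup_iff.1 (V⁻¹).2).1
  calc ‖(((V⁻¹ : Matrix.specialUnitaryGroup (Fin 2) ℂ)) : Matrix (Fin 2) (Fin 2) ℂ) * R * ((V : Matrix.specialUnitaryGroup (Fin 2) ℂ) : Matrix (Fin 2) (Fin 2) ℂ)‖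
      ≤ ‖(((V⁻¹ : Matrix.specialUnitaryGroup (Fin 2) ℂ)) : Matrix (Fin 2) (Fin 2) ℂ) * R‖ * ‖((V : Matrix.specialUnitaryGroup (Fin 2) ℂ) : Matrix (Fin 2) (Fin 2) ℂ)‖ :=
        norm_mul_le _ _
    _ ≤ ‖(((V⁻¹ : Matrix.specialUnitaryGroup (Fin 2) ℂ)) : Matrix (Fin 2) (Fin 2) ℂ)‖ * ‖R‖ * ‖((V : Matrix.specialUnitaryGroup (Fin 2) ℂ) : Matrix (Fin 2) (Fin 2) ℂ)‖ :=
        mul_le_mul_of_nonneg_right (norm_mul_le _ _) (norm_nonneg _)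
    _ = ‖R‖ := by rw [hV, hVi, one_mul, mul_one]

/-- ★★ **THE LINEARISED COULOMB CONDITION WITH CUBIC DEFECT.**  At a box-`ℓ²`-orbit-minimising pair `(U, U')` (`∀ k, Σ_box dist1(U_bU'_b⁻¹)² ≤
Σ_box dist1(U_b((U'^k)_b)⁻¹)²`), if the perturbation is written `U'_bU_b⁻¹ = exp Y_b` with `‖Y_b‖ ≤ 1` on the box bonds at `x`, then the covariant
lattice divergence of `Y` at `x` is third-order small:
`‖Σ_{b∈box,b₋=x} Y_b − Σ_{b∈box,b₊=x} U_b⁻¹Y_bU_b‖ ≤ Σ_{b∈box,b₋=x} ‖Y_b‖³ + Σ_{b∈box,b₊=x} ‖Y_b‖³`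
(✓`kirchhoff_of_orbitMin` read through `e^Y − e^{−Y} = 2Y + O(‖Y‖³)`). [cite: Balaban1985Averaging, (156)–(163) p.42 (the regime this opens)] -/
theorem norm_covDiv_le_of_orbitMin (box : PBond P 0 → Prop) [DecidablePred box]
    (U U' : GaugeField P 0 (Matrix.specialUnitaryGroup (Fin 2) ℂ))
    (hmin : ∀ k : GaugeTransf P 0 (Matrix.specialUnitaryGroup (Fin 2) ℂ),
      (∑ b : PBond P 0, if box b then dist1 (U b * (U' b)⁻¹) ^ 2 else 0) ≤
        ∑ b : PBond P 0, if box b then dist1 (U b * (GaugeField.gaugeAct k U' b)⁻¹) ^ 2 else 0)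
    (x : Site P 0) (Y : PBond P 0 → Matrix (Fin 2) (Fin 2) ℂ)
    (hW : ∀ b : PBond P 0, box b → (b.src = x ∨ b.tgt = x) →
      ((U' b : Matrix.specialUnitaryGroup (Fin 2) ℂ) : Matrix (Fin 2) (Fin 2) ℂ) * (((U b)⁻¹ : Matrix.specialUnitaryGroup (Fin 2) ℂ) : Matrix (Fin 2) (Fin 2) ℂ) = exp (Y b))
    (hY : ∀ b : PBond P 0, box b → (b.src = x ∨ b.tgt = x) → ‖Y b‖ ≤ 1) :
    ‖(∑ b : PBond P 0, if box b ∧ b.src = x then Y b else 0) -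
        ∑ b : PBond P 0, if box b ∧ b.tgt = x then
          (((U b)⁻¹ : Matrix.specialUnitaryGroup (Fin 2) ℂ) : Matrix (Fin 2) (Fin 2) ℂ) * Y b * ((U b : Matrix.specialUnitaryGroup (Fin 2) ℂ) : Matrix (Fin 2) (Fin 2) ℂ) else 0‖ ≤
      (∑ b : PBond P 0, if box b ∧ b.src = x then ‖Y b‖ ^ 3 else 0) + ∑ b : PBond P 0, if box b ∧ b.tgt = x then ‖Y b‖ ^ 3 else 0 := by
  letI : NormedAlgebra ℚ (Matrix (Fin 2) (Fin 2) ℂ) := NormedAlgebra.restrictScalars ℚ ℂ _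
  -- abbreviations
  set Uc : PBond P 0 → Matrix (Fin 2) (Fin 2) ℂ := fun b => ((U b : Matrix.specialUnitaryGroup (Fin 2) ℂ) : Matrix (Fin 2) (Fin 2) ℂ) with hUc
  set Ui : PBond P 0 → Matrix (Fin 2) (Fin 2) ℂ := fun b => (((U b)⁻¹ : Matrix.specialUnitaryGroup (Fin 2) ℂ) : Matrix (Fin 2) (Fin 2) ℂ) with hUi
  set R : PBond P 0 → Matrix (Fin 2) (Fin 2) ℂ := fun b => (exp (Y b) - exp (-(Y b))) - (2 : ℂ) • Y b with hR
  -- `exp(−Y_b) = U_b U'_b⁻¹` on the bonds at `x`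
  have hWinv : ∀ b : PBond P 0, box b → (b.src = x ∨ b.tgt = x) →
      ((U b : Matrix.specialUnitaryGroup (Fin 2) ℂ) : Matrix (Fin 2) (Fin 2) ℂ) * (((U' b)⁻¹ : Matrix.specialUnitaryGroup (Fin 2) ℂ) : Matrix (Fin 2) (Fin 2) ℂ) = exp (-(Y b)) := by
    intro b hb hx
    have h1 : exp (-(Y b)) * exp (Y b) = 1 := by
      rw [← exp_add_of_commute (Commute.refl (Y b)).neg_left, neg_add_cancel, exp_zero]
    have h2 : exp (Y b) * (((U b : Matrix.specialUnitaryGroup (Fin 2) ℂ) : Matrix (Fin 2) (Fin 2) ℂ) * (((U' b)⁻¹ : Matrix.specialUnitaryGroup (Fin 2) ℂ) : Matrix (Fin 2) (Fin 2) ℂ)) = 1 := by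
      rw [← hW b hb hx, ← Submonoid.coe_mul, ← Submonoid.coe_mul, ← Submonoid.coe_mul]
      rw [show U' b * (U b)⁻¹ * (U b * (U' b)⁻¹) = 1 by group]
      rfl
    calc ((U b : Matrix.specialUnitaryGroup (Fin 2) ℂ) : Matrix (Fin 2) (Fin 2) ℂ) * (((U' b)⁻¹ : Matrix.specialUnitaryGroup (Fin 2) ℂ) : Matrix (Fin 2) (Fin 2) ℂ)
        = (exp (-(Y b)) * exp (Y b)) * (((U b : Matrix.specialUnitaryGroup (Fin 2) ℂ) : Matrix (Fin 2) (Fin 2) ℂ) * (((U' b)⁻¹ : Matrix.specialUnitaryGroup (Fin 2) ℂ) : Matrix (Fin 2) (Fin 2) ℂ)) := by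
          rw [h1, one_mul]
      _ = exp (-(Y b)) := by rw [mul_assoc, h2, mul_one]
  -- Kirchhoff, read in the exponential letters: `Σ_out (2Y + R) = Σ_in U⁻¹(2Y + R)U`
  have hK := kirchhoff_of_orbitMin box U U' hmin x
  have hout : (∑ b : PBond P 0, if box b ∧ b.src = x then
        ((((U' b : Matrix.specialUnitaryGroup (Fin 2) ℂ) : Matrix (Fin 2) (Fin 2) ℂ) * (((U b)⁻¹ : Matrix.specialUnitaryGroup (Fin 2) ℂ) : Matrix (Fin 2) (Fin 2) ℂ)) -
          (((U b : Matrix.specialUnitaryGroup (Fin 2) ℂ) : Matrix (Fin 2) (Fin 2) ℂ) * (((U' b)⁻¹ : Matrix.specialUnitaryGroup (Fin 2) ℂ) : Matrix (Fin 2) (Fin 2) ℂ))) else 0) =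
      ∑ b : PBond P 0, if box b ∧ b.src = x then ((2 : ℂ) • Y b + R b) else 0 := by
    refine Finset.sum_congr rfl fun b _ => ?_
    by_cases h : box b ∧ b.src = x
    · rw [if_pos h, if_pos h, hW b h.1 (Or.inl h.2), hWinv b h.1 (Or.inl h.2), hR]
      exact (add_sub_cancel _ _).symm
    · rw [if_neg h, if_neg h]
  have hin : (∑ b : PBond P 0, if box b ∧ b.tgt = x then
        ((((U b)⁻¹ : Matrix.specialUnitaryGroup (Fin 2) ℂ) : Matrix (Fin 2) (Fin 2) ℂ) * ((U' b : Matrix.specialUnitaryGroup (Fin 2) ℂ) : Matrix (Fin 2) (Fin 2) ℂ) -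
          ((((U' b)⁻¹ : Matrix.specialUnitaryGroup (Fin 2) ℂ) : Matrix (Fin 2) (Fin 2) ℂ) * ((U b : Matrix.specialUnitaryGroup (Fin 2) ℂ) : Matrix (Fin 2) (Fin 2) ℂ))) else 0) =
      ∑ b : PBond P 0, if box b ∧ b.tgt = x then Ui b * ((2 : ℂ) • Y b + R b) * Uc b else 0 := by
    refine Finset.sum_congr rfl fun b _ => ?_
    by_cases h : box b ∧ b.tgt = x
    · rw [if_pos h, if_pos h]
      -- `U⁻¹U' = U⁻¹ (U'U⁻¹) U` and `U'⁻¹U = U⁻¹ (U U'⁻¹) U`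
      have e1 : ((((U b)⁻¹ : Matrix.specialUnitaryGroup (Fin 2) ℂ) : Matrix (Fin 2) (Fin 2) ℂ) * ((U' b : Matrix.specialUnitaryGroup (Fin 2) ℂ) : Matrix (Fin 2) (Fin 2) ℂ)) =
          Ui b * (((U' b : Matrix.specialUnitaryGroup (Fin 2) ℂ) : Matrix (Fin 2) (Fin 2) ℂ) * (((U b)⁻¹ : Matrix.specialUnitaryGroup (Fin 2) ℂ) : Matrix (Fin 2) (Fin 2) ℂ)) * Uc b := by
        rw [hUi, hUc, ← Submonoid.coe_mul, ← Submonoid.coe_mul, ← Submonoid.coe_mul, ← Submonoid.coe_mul]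
        congr 1
        group
      have e2 : ((((U' b)⁻¹ : Matrix.specialUnitaryGroup (Fin 2) ℂ) : Matrix (Fin 2) (Fin 2) ℂ) * ((U b : Matrix.specialUnitaryGroup (Fin 2) ℂ) : Matrix (Fin 2) (Fin 2) ℂ)) =
          Ui b * (((U b : Matrix.specialUnitaryGroup (Fin 2) ℂ) : Matrix (Fin 2) (Fin 2) ℂ) * (((U' b)⁻¹ : Matrix.specialUnitaryGroup (Fin 2) ℂ) : Matrix (Fin 2) (Fin 2) ℂ)) * Uc b := by
        rw [hUi, hUc, ← Submonoid.coe_mul, ← Submonoid.coe_mul, ← Submonoid.coe_mul, ← Submonoid.coe_mul]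
        congr 1
        group
      rw [e1, e2, hW b h.1 (Or.inr h.2), hWinv b h.1 (Or.inr h.2), hR]
      simp only [add_sub_cancel]
      rw [mul_sub, sub_mul]
    · rw [if_neg h, if_neg h]
  rw [hout, hin] at hK
  -- split the sums: `2·(Σ_out Y − Σ_in U⁻¹YU) = −Σ_out R + Σ_in U⁻¹RU`
  have hsplit_out : (∑ b : PBond P 0, if box b ∧ b.src = x then ((2 : ℂ) • Y b + R b) else 0) =
      (2 : ℂ) • (∑ b : PBond P 0, if box b ∧ b.src = x then Y b else 0) + ∑ b : PBond P 0, if box b ∧ b.src = x then R b else 0 := by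
    rw [Finset.smul_sum, ← Finset.sum_add_distrib]
    exact Finset.sum_congr rfl fun b _ => by split_ifs <;> simp
  have hsplit_in : (∑ b : PBond P 0, if box b ∧ b.tgt = x then Ui b * ((2 : ℂ) • Y b + R b) * Uc b else 0) =
      (2 : ℂ) • (∑ b : PBond P 0, if box b ∧ b.tgt = x then Ui b * Y b * Uc b else 0) + ∑ b : PBond P 0, if box b ∧ b.tgt = x then Ui b * R b * Uc b else 0 := by
    rw [Finset.smul_sum, ← Finset.sum_add_distrib]
    exact Finset.sum_congr rfl fun b _ => by
      split_ifs
      · rw [mul_add, add_mul, Matrix.mul_smul, Matrix.smul_mul]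
      · simp
  rw [hsplit_out, hsplit_in] at hK
  have hdiff : (2 : ℂ) • ((∑ b : PBond P 0, if box b ∧ b.src = x then Y b else 0) - ∑ b : PBond P 0, if box b ∧ b.tgt = x then Ui b * Y b * Uc b else 0) =
      (∑ b : PBond P 0, if box b ∧ b.tgt = x then Ui b * R b * Uc b else 0) - ∑ b : PBond P 0, if box b ∧ b.src = x then R b else 0 := by
    -- `2A + C = 2B + D` ⇒ `2A − 2B = D − C`
    rw [smul_sub, sub_eq_sub_iff_add_eq_add, hK, add_comm]
  -- norms
  have h2 : ‖(2 : ℂ) • ((∑ b : PBond P 0, if box b ∧ b.src = x then Y b else 0) - ∑ b : PBond P 0, if box b ∧ b.tgt = x then Ui b * Y b * Uc b else 0)‖ =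
      2 * ‖(∑ b : PBond P 0, if box b ∧ b.src = x then Y b else 0) - ∑ b : PBond P 0, if box b ∧ b.tgt = x then Ui b * Y b * Uc b else 0‖ := by
    rw [norm_smul]
    norm_num
  have hRb : ∀ b : PBond P 0, box b → (b.src = x ∨ b.tgt = x) → ‖R b‖ ≤ 2 * ‖Y b‖ ^ 3 := fun b hb hx =>
    norm_exp_sub_exp_neg_sub_two_smul_le (Y b) (hY b hb hx)
  have hsumR_out : ‖∑ b : PBond P 0, if box b ∧ b.src = x then R b else 0‖ ≤ ∑ b : PBond P 0, if box b ∧ b.src = x then 2 * ‖Y b‖ ^ 3 else 0 := by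
    refine (norm_sum_le _ _).trans (Finset.sum_le_sum fun b _ => ?_)
    by_cases h : box b ∧ b.src = x
    · rw [if_pos h, if_pos h]; exact hRb b h.1 (Or.inl h.2)
    · rw [if_neg h, if_neg h, norm_zero]
  have hsumR_in : ‖∑ b : PBond P 0, if box b ∧ b.tgt = x then Ui b * R b * Uc b else 0‖ ≤ ∑ b : PBond P 0, if box b ∧ b.tgt = x then 2 * ‖Y b‖ ^ 3 else 0 := by
    refine (norm_sum_le _ _).trans (Finset.sum_le_sum fun b _ => ?_)
    by_cases h : box b ∧ b.tgt = x
    · rw [if_pos h, if_pos h]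
      exact (norm_conj_le (U b) (R b)).trans (hRb b h.1 (Or.inr h.2))
    · rw [if_neg h, if_neg h, norm_zero]
  have hfin : 2 * ‖(∑ b : PBond P 0, if box b ∧ b.src = x then Y b else 0) - ∑ b : PBond P 0, if box b ∧ b.tgt = x then Ui b * Y b * Uc b else 0‖ ≤
      (∑ b : PBond P 0, if box b ∧ b.tgt = x then 2 * ‖Y b‖ ^ 3 else 0) + ∑ b : PBond P 0, if box b ∧ b.src = x then 2 * ‖Y b‖ ^ 3 else 0 := by
    rw [← h2, hdiff]
    exact (norm_sub_le _ _).trans (add_le_add hsumR_in hsumR_out)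
  have e_out : (∑ b : PBond P 0, if box b ∧ b.src = x then 2 * ‖Y b‖ ^ 3 else 0) = 2 * ∑ b : PBond P 0, if box b ∧ b.src = x then ‖Y b‖ ^ 3 else 0 := by
    rw [Finset.mul_sum]; exact Finset.sum_congr rfl fun b _ => by split_ifs <;> simp
  have e_in : (∑ b : PBond P 0, if box b ∧ b.tgt = x then 2 * ‖Y b‖ ^ 3 else 0) = 2 * ∑ b : PBond P 0, if box b ∧ b.tgt = x then ‖Y b‖ ^ 3 else 0 := by
    rw [Finset.mul_sum]; exact Finset.sum_congr rfl fun b _ => by split_ifs <;> simp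
  rw [e_out, e_in] at hfin
  have : ‖(∑ b : PBond P 0, if box b ∧ b.src = x then Y b else 0) - ∑ b : PBond P 0, if box b ∧ b.tgt = x then Ui b * Y b * Uc b else 0‖ ≤
      (∑ b : PBond P 0, if box b ∧ b.src = x then ‖Y b‖ ^ 3 else 0) + ∑ b : PBond P 0, if box b ∧ b.tgt = x then ‖Y b‖ ^ 3 else 0 := by
    linarith
  simpa only [hUi, hUc] using this

end Summit.QuantumFields.YangMills.Theorems.PoincareLipschitzOrbitMinLinearCoulomb
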